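import Literature.NumberTheory.Transcendental.TaylorCoeffPadicDiv
import Mathlib.RingTheory.PowerSeries.Basic
import HarnessLib

/-!
# `p`-scaled Taylor series of rational functions as formal power series

Topic `Literature/NumberTheory/Transcendental`.  Companion of `TaylorCoeffPadic.lean` /
`TaylorCoeffPadicDiv.lean`.  For a function `f : ℚ → ℚ` smooth at `x` and a prime `p` we package ALL
the scaled Taylor coefficients `p^j · (1/j!) f^{(j)}(x)` into one formal power series
`pTaylor p f x = Σ_j p^j 𝒟_j f(x) X^j ∈ ℚ⟦X⟧` (the Taylor series of `t ↦ f(x + p t)`).  Because the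
Leibniz rule for divided derivatives has no binomial coefficients, `pTaylor` is EXACTLY multiplicative
(`pTaylor_fun_mul`, `pTaylor_fun_pow`, `pTaylor_fun_prod`), and the elementary factors of the bricks of
[Zudilin2004, §7] have the explicit series `pTaylor (t ↦ t + c) = C(x+c) + p·X`,
`pTaylor (t ↦ (t+c)⁻¹) = (C(x+c) + p·X)⁻¹ = Σ_j (−p)^j (x+c)^{−j−1} X^j` (`invLin`).  The `p`-adic
book-keeping then happens inside `ℚ⟦X⟧` with the predicate `PSOrdGe p v F` ("every coefficient of `F` has
`p`-adic order `≥ v`"), which is additive, multiplicative (orders add) and supports congruences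
`PSOrdGe p 1 (F − G)`.  This refines `IsDOrdDiv` (= `PSOrdGe p e (pTaylor p f x)`) by remembering the
residues of the scaled coefficients, which is what cancellation arguments ACROSS several expansion points
need ([LaiSprangZudilin2026, Lemma 5.3]: one `p` is gained only after summing over the poles).
Everything here is PROVED (no named facts).

## References

* [Zudilin2004] W. Zudilin, *Arithmetic of linear forms involving odd zeta values*, J. Théor. Nombres
  Bordeaux 16 (2004), 251–291, §7 (Lemmas 17–18: `p`-adic orders of `R^{(j)}(−k)/j!` factor by factor).
* [LaiSprangZudilin2026] L. Lai, J. Sprang, W. Zudilin, *A note on the irrationality of ζ₂(5)*,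
  arXiv:2505.05005, §5 (Lemma 5.3).
-/

noncomputable section

open Finset Filter PowerSeries Literature.Analysis.Calculus
open scoped Nat

namespace Literature.NumberTheory.Transcendental

/-! ### The `p`-scaled Taylor series -/

/-- The `p`-scaled Taylor series `Σ_j p^j 𝒟_j f(x) X^j` of `f` at `x` (the Taylor series of
`t ↦ f(x + p t)` at `0`). [cite: Zudilin2004, §7 (the operators (1/j!) d^j/dt^j)] -/
def pTaylor (p : ℕ) (f : ℚ → ℚ) (x : ℚ) : ℚ⟦X⟧ :=
  PowerSeries.mk fun j => (p : ℚ) ^ j * divDeriv j f x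

variable {p : ℕ} {f g : ℚ → ℚ} {x : ℚ}

/-- Coefficients of `pTaylor`. [cite: Zudilin2004, §7 (Lemmas 16–18: Leibniz rule for (1/j!)R^{(j)}(−k))] -/
@[simp] theorem coeff_pTaylor (p : ℕ) (f : ℚ → ℚ) (x : ℚ) (j : ℕ) :
    coeff j (pTaylor p f x) = (p : ℚ) ^ j * divDeriv j f x := by
  rw [pTaylor, coeff_mk]

/-- The constant coefficient of `pTaylor p f x` is the value `f x`. [cite: Zudilin2004, §7 (Lemmas 16–18: Leibniz rule for (1/j!)R^{(j)}(−k))] -/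
@[simp] theorem constantCoeff_pTaylor (p : ℕ) (f : ℚ → ℚ) (x : ℚ) :
    constantCoeff (pTaylor p f x) = f x := by
  rw [← coeff_zero_eq_constantCoeff_apply, coeff_pTaylor, pow_zero, one_mul, divDeriv_zero]

/-- **Exact multiplicativity** (binomial-free Leibniz rule): for `f`, `g` smooth at `x`,
`pTaylor p (f·g) x = pTaylor p f x · pTaylor p g x`. [cite: Zudilin2004, §7 (Lemmas 16–18: Leibniz rule for (1/j!)R^{(j)}(−k))] -/
theorem pTaylor_fun_mul (hf : ContDiffAt ℚ (⊤ : ℕ∞) f x) (hg : ContDiffAt ℚ (⊤ : ℕ∞) g x) :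
    pTaylor p (fun t => f t * g t) x = pTaylor p f x * pTaylor p g x := by
  ext j
  rw [coeff_pTaylor, coeff_mul, divDeriv_fun_mul (hf.of_le (mod_cast le_top)) (hg.of_le (mod_cast le_top)),
    Finset.Nat.sum_antidiagonal_eq_sum_range_succ_mk, mul_sum]
  refine sum_congr rfl fun i hi => ?_
  have hij : i ≤ j := Nat.lt_succ_iff.1 (mem_range.1 hi)
  rw [coeff_pTaylor, coeff_pTaylor]
  have : (p : ℚ) ^ j = (p : ℚ) ^ i * (p : ℚ) ^ (j - i) := by
    rw [← pow_add]; congr 1; omega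
  rw [this]; ring

/-- Smoothness of a pointwise power. [cite: Zudilin2004, §7 (Lemmas 16–18: Leibniz rule for (1/j!)R^{(j)}(−k))] -/
private theorem contDiffAt_fun_pow (hf : ContDiffAt ℚ (⊤ : ℕ∞) f x) (n : ℕ) :
    ContDiffAt ℚ (⊤ : ℕ∞) (fun t => f t ^ n) x := hf.pow n

/-- `pTaylor` of a power. [cite: Zudilin2004, §7 (Lemmas 16–18: Leibniz rule for (1/j!)R^{(j)}(−k))] -/
theorem pTaylor_fun_pow (hf : ContDiffAt ℚ (⊤ : ℕ∞) f x) (n : ℕ) :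
    pTaylor p (fun t => f t ^ n) x = pTaylor p f x ^ n := by
  induction n with
  | zero =>
    ext j
    simp only [pow_zero, coeff_pTaylor, coeff_one]
    rw [show (fun _ : ℚ => (1 : ℚ)) = fun t : ℚ => (0 : ℚ) * t + 1 from funext fun t => by ring, divDeriv_affine]
    rcases j with _ | _ | j <;> simp
  | succ n ih =>
    have e : (fun t => f t ^ (n + 1)) = fun t => f t ^ n * f t := funext fun t => pow_succ _ _
    rw [e, pTaylor_fun_mul (contDiffAt_fun_pow hf n) hf, ih, pow_succ]

/-- `pTaylor` of a finite product of smooth functions. [cite: Zudilin2004, §7 (Lemmas 16–18: Leibniz rule for (1/j!)R^{(j)}(−k))] -/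
theorem pTaylor_fun_prod {ι : Type*} (s : Finset ι) {F : ι → ℚ → ℚ}
    (hF : ∀ i ∈ s, ContDiffAt ℚ (⊤ : ℕ∞) (F i) x) :
    pTaylor p (fun t => ∏ i ∈ s, F i t) x = ∏ i ∈ s, pTaylor p (F i) x := by
  classical
  induction s using Finset.induction_on with
  | empty =>
    ext j
    simp only [prod_empty, coeff_pTaylor, coeff_one]
    rw [show (fun _ : ℚ => (1 : ℚ)) = fun t : ℚ => (0 : ℚ) * t + 1 from funext fun t => by ring, divDeriv_affine]
    rcases j with _ | _ | j <;> simp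
  | insert a s ha ih =>
    have hs : ∀ i ∈ s, ContDiffAt ℚ (⊤ : ℕ∞) (F i) x := fun i hi => hF i (mem_insert_of_mem hi)
    have e : (fun t => ∏ i ∈ insert a s, F i t) = fun t => F a t * ∏ i ∈ s, F i t :=
      funext fun t => prod_insert ha
    rw [e, pTaylor_fun_mul (hF a (mem_insert_self a s)) (contDiffAt_prod hs), ih hs, prod_insert ha]

/-- `pTaylor` of a constant. [cite: Zudilin2004, §7 (Lemmas 16–18: Leibniz rule for (1/j!)R^{(j)}(−k))] -/
theorem pTaylor_const (p : ℕ) (c x : ℚ) : pTaylor p (fun _ => c) x = C c := by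
  ext j
  rw [coeff_pTaylor, coeff_C,
    show (fun _ : ℚ => c) = fun t : ℚ => (0 : ℚ) * t + c from funext fun t => by ring, divDeriv_affine]
  rcases j with _ | _ | j <;> simp

/-- `pTaylor` of an affine function: `C(a x + c) + a p · X`. [cite: Zudilin2004, §7 (Lemmas 16–18: Leibniz rule for (1/j!)R^{(j)}(−k))] -/
theorem pTaylor_affine (p : ℕ) (a c x : ℚ) :
    pTaylor p (fun t => a * t + c) x = C (a * x + c) + C (a * p) * X := by
  ext j
  rw [coeff_pTaylor, divDeriv_affine, map_add, coeff_C, coeff_C_mul, coeff_X]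
  rcases j with _ | _ | j
  · simp
  · simp; ring
  · simp

/-- `pTaylor` of a linear factor `t + c`: `C(x + c) + p·X`. [cite: Zudilin2004, §7 (Lemmas 16–18: Leibniz rule for (1/j!)R^{(j)}(−k))] -/
theorem pTaylor_add_const (p : ℕ) (c x : ℚ) :
    pTaylor p (fun t => t + c) x = C (x + c) + C (p : ℚ) * X := by
  have := pTaylor_affine p 1 c x
  simp only [one_mul] at this
  exact this

/-- The geometric series `Σ_j (−q)^j w^{−j−1} X^j = (C w + q·X)⁻¹` (for `w ≠ 0`). [cite: Zudilin2004, §7 (Lemmas 16–18: Leibniz rule for (1/j!)R^{(j)}(−k))] -/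
def invLin (q w : ℚ) : ℚ⟦X⟧ :=
  PowerSeries.mk fun j => (-q) ^ j / w ^ (j + 1)

/-- Coefficients of `invLin`. [cite: Zudilin2004, §7 (Lemmas 16–18: Leibniz rule for (1/j!)R^{(j)}(−k))] -/
@[simp] theorem coeff_invLin (q w : ℚ) (j : ℕ) : coeff j (invLin q w) = (-q) ^ j / w ^ (j + 1) := by
  rw [invLin, coeff_mk]

/-- Constant coefficient of `invLin`. [cite: Zudilin2004, §7 (Lemmas 16–18: Leibniz rule for (1/j!)R^{(j)}(−k))] -/
@[simp] theorem constantCoeff_invLin (q w : ℚ) : constantCoeff (invLin q w) = w⁻¹ := by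
  rw [← coeff_zero_eq_constantCoeff_apply, coeff_invLin]
  simp

/-- `invLin q w · (C w + q X) = 1` (`w ≠ 0`): it is the inverse of the linear series. [cite: Zudilin2004, §7 (Lemmas 16–18: Leibniz rule for (1/j!)R^{(j)}(−k))] -/
theorem invLin_mul_lin {q w : ℚ} (hw : w ≠ 0) : invLin q w * (C w + C q * X) = 1 := by
  ext j
  rw [mul_add, map_add, coeff_mul_C, coeff_one]
  rcases j with _ | j
  · simp only [coeff_zero_eq_constantCoeff, map_mul, constantCoeff_invLin, constantCoeff_C,
      constantCoeff_X, mul_zero, add_zero]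
    simp [inv_mul_cancel₀ hw]
  · rw [show C q * X = X * C q by ring, ← mul_assoc, coeff_mul_C, coeff_succ_mul_X, coeff_invLin,
      coeff_invLin, if_neg (Nat.succ_ne_zero j)]
    rw [pow_succ, pow_succ]
    field_simp
    ring

/-- Rescaling: `invLin q (q β) = q⁻¹ · invLin 1 β` (used with `q = p` at a pole at distance `p β`).
[cite: Zudilin2004, §7 (Lemmas 16–18: Leibniz rule for (1/j!)R^{(j)}(−k))] -/
theorem invLin_scale {q : ℚ} (hq : q ≠ 0) (β : ℚ) : invLin q (q * β) = C q⁻¹ * invLin 1 β := by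
  ext j
  rw [coeff_invLin, coeff_C_mul, coeff_invLin, neg_pow q, neg_pow (1 : ℚ), one_pow, mul_one, mul_pow]
  by_cases hβ : β = 0
  · subst hβ; simp
  field_simp
  ring

/-- `pTaylor` of an inverse linear factor `(t + c)⁻¹` at `x` with `x + c ≠ 0`:
`Σ_j (−p)^j (x+c)^{−j−1} X^j`. [cite: Zudilin2004, §7 Lemma 18 (proof)] -/
theorem pTaylor_inv_add_const (p : ℕ) {c x : ℚ} (h : x + c ≠ 0) :
    pTaylor p (fun t => (t + c)⁻¹) x = invLin p (x + c) := by
  ext j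
  rw [coeff_pTaylor, coeff_invLin, divDeriv_inv_add_const j h, neg_pow (p : ℚ)]
  ring

/-! ### `p`-adic orders of all coefficients of a power series -/

/-- `PSOrdGe p v F`: every coefficient of `F ∈ ℚ⟦X⟧` has `p`-adic order `≥ v` (vacuous for zero
coefficients). [cite: Zudilin2004, §7 (Lemmas 16–18: Leibniz rule for (1/j!)R^{(j)}(−k))] -/
def PSOrdGe (p : ℕ) (v : ℤ) (F : ℚ⟦X⟧) : Prop :=
  ∀ j, PadicOrdGe p v (coeff j F)

namespace PSOrdGe

variable {p : ℕ} {v w : ℤ} {F G F' G' : ℚ⟦X⟧}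

/-- [cite: Zudilin2004, §7 (Lemmas 16–18: Leibniz rule for (1/j!)R^{(j)}(−k))] -/
theorem coeff (h : PSOrdGe p v F) (j : ℕ) : PadicOrdGe p v (PowerSeries.coeff j F) := h j

/-- [cite: Zudilin2004, §7 (Lemmas 16–18: Leibniz rule for (1/j!)R^{(j)}(−k))] -/
theorem zero (p : ℕ) (v : ℤ) : PSOrdGe p v (0 : ℚ⟦X⟧) := fun j => by
  rw [map_zero]; exact PadicOrdGe.zero v

/-- [cite: Zudilin2004, §7 (Lemmas 16–18: Leibniz rule for (1/j!)R^{(j)}(−k))] -/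
theorem mono (h : PSOrdGe p w F) (hvw : v ≤ w) : PSOrdGe p v F := fun j => (h j).mono hvw

/-- [cite: Zudilin2004, §7 (Lemmas 16–18: Leibniz rule for (1/j!)R^{(j)}(−k))] -/
theorem add [Fact p.Prime] (hF : PSOrdGe p v F) (hG : PSOrdGe p v G) : PSOrdGe p v (F + G) := fun j => by
  rw [map_add]; exact (hF j).add (hG j)

/-- [cite: Zudilin2004, §7 (Lemmas 16–18: Leibniz rule for (1/j!)R^{(j)}(−k))] -/
theorem neg (hF : PSOrdGe p v F) : PSOrdGe p v (-F) := fun j => by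
  rw [map_neg]
  rcases hF j with h | h
  · exact Or.inl (by rw [h, neg_zero])
  · exact Or.inr (by rwa [padicValRat.neg])

/-- [cite: Zudilin2004, §7 (Lemmas 16–18: Leibniz rule for (1/j!)R^{(j)}(−k))] -/
theorem sub [Fact p.Prime] (hF : PSOrdGe p v F) (hG : PSOrdGe p v G) : PSOrdGe p v (F - G) := by
  rw [sub_eq_add_neg]; exact hF.add hG.neg

/-- Finite sums. [cite: Zudilin2004, §7 (Lemmas 16–18: Leibniz rule for (1/j!)R^{(j)}(−k))] -/
theorem sum [Fact p.Prime] {ι : Type*} {s : Finset ι} {Φ : ι → ℚ⟦X⟧} (h : ∀ i ∈ s, PSOrdGe p v (Φ i)) :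
    PSOrdGe p v (∑ i ∈ s, Φ i) := fun j => by
  rw [map_sum]; exact PadicOrdGe.sum fun i hi => h i hi j

/-- Products: the orders add (Cauchy product). [cite: Zudilin2004, §7 (Lemmas 16–18: Leibniz rule for (1/j!)R^{(j)}(−k))] -/
theorem mul [Fact p.Prime] (hF : PSOrdGe p v F) (hG : PSOrdGe p w G) : PSOrdGe p (v + w) (F * G) := fun j => by
  rw [coeff_mul]
  exact PadicOrdGe.sum fun ij _ => (hF ij.1).mul (hG ij.2)

/-- Powers (non-negative order). [cite: Zudilin2004, §7 (Lemmas 16–18: Leibniz rule for (1/j!)R^{(j)}(−k))] -/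
theorem pow [Fact p.Prime] (hF : PSOrdGe p 0 F) (n : ℕ) : PSOrdGe p 0 (F ^ n) := by
  induction n with
  | zero => intro j; rw [pow_zero, coeff_one]; split_ifs
            · exact PadicOrdGe.of_int 1 |>.mono le_rfl |> fun h => by simpa using h
            · exact PadicOrdGe.zero 0
  | succ n ih => rw [pow_succ]; simpa using ih.mul hF

/-- Finite products (non-negative order). [cite: Zudilin2004, §7 (Lemmas 16–18: Leibniz rule for (1/j!)R^{(j)}(−k))] -/
theorem prod [Fact p.Prime] {ι : Type*} (s : Finset ι) {Φ : ι → ℚ⟦X⟧} (h : ∀ i ∈ s, PSOrdGe p 0 (Φ i)) :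
    PSOrdGe p 0 (∏ i ∈ s, Φ i) := by
  classical
  induction s using Finset.induction_on with
  | empty => rw [prod_empty]; simpa using (zero p 0).pow 0 |> fun _ => (show PSOrdGe p 0 (1 : ℚ⟦X⟧) from
      fun j => by rw [coeff_one]; split_ifs; exacts [by simpa using PadicOrdGe.of_int (p := p) 1, PadicOrdGe.zero 0])
  | insert a s ha ih =>
    rw [prod_insert ha]
    simpa using (h a (mem_insert_self a s)).mul (ih fun i hi => h i (mem_insert_of_mem hi))

/-- The series `1`. [cite: Zudilin2004, §7 (Lemmas 16–18: Leibniz rule for (1/j!)R^{(j)}(−k))] -/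
theorem one (p : ℕ) : PSOrdGe p 0 (1 : ℚ⟦X⟧) := fun j => by
  rw [coeff_one]; split_ifs
  · simpa using PadicOrdGe.of_int (p := p) 1
  · exact PadicOrdGe.zero 0

/-- Constants. [cite: Zudilin2004, §7 (Lemmas 16–18: Leibniz rule for (1/j!)R^{(j)}(−k))] -/
theorem C {c : ℚ} (hc : PadicOrdGe p v c) : PSOrdGe p v (PowerSeries.C c) := fun j => by
  rw [coeff_C]; split_ifs
  · exact hc
  · exact PadicOrdGe.zero v

/-- The variable `X`. [cite: Zudilin2004, §7 (Lemmas 16–18: Leibniz rule for (1/j!)R^{(j)}(−k))] -/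
theorem X (p : ℕ) : PSOrdGe p 0 (PowerSeries.X : ℚ⟦X⟧) := fun j => by
  rw [coeff_X]; split_ifs
  · simpa using PadicOrdGe.of_int (p := p) 1
  · exact PadicOrdGe.zero 0

/-- `ord_p p ≥ 1`. [cite: Zudilin2004, §7 (Lemmas 16–18: Leibniz rule for (1/j!)R^{(j)}(−k))] -/
theorem _root_.Literature.NumberTheory.Transcendental.padicOrdGe_one_natCast (p : ℕ) [hp : Fact p.Prime] :
    PadicOrdGe p 1 (p : ℚ) :=
  PadicOrdGe.of_eq (by rw [padicValRat.self hp.out.one_lt])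

/-- `p · X` has order `≥ 1`. [cite: Zudilin2004, §7 (Lemmas 16–18: Leibniz rule for (1/j!)R^{(j)}(−k))] -/
theorem C_p_mul_X (p : ℕ) [Fact p.Prime] : PSOrdGe p 1 (PowerSeries.C (p : ℚ) * PowerSeries.X) := by
  simpa using (C (padicOrdGe_one_natCast p)).mul (X p)

/-- Congruent factors give congruent products: `F ≡ F'`, `G ≡ G'` (mod `p`), all `p`-integral ⇒
`FG ≡ F'G'` (mod `p`). [cite: Zudilin2004, §7 (Lemmas 16–18: Leibniz rule for (1/j!)R^{(j)}(−k))] -/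
theorem mul_congr [Fact p.Prime] (hF : PSOrdGe p 0 F) (hG' : PSOrdGe p 0 G')
    (hFF : PSOrdGe p 1 (F - F')) (hGG : PSOrdGe p 1 (G - G')) : PSOrdGe p 1 (F * G - F' * G') := by
  have e : F * G - F' * G' = F * (G - G') + (F - F') * G' := by ring
  rw [e]
  simpa using (hF.mul hGG).add (hFF.mul hG')

/-- Congruent families give congruent products. [cite: Zudilin2004, §7 (Lemmas 16–18: Leibniz rule for (1/j!)R^{(j)}(−k))] -/
theorem prod_congr [Fact p.Prime] {ι : Type*} (s : Finset ι) {Φ Ψ : ι → ℚ⟦X⟧}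
    (hΦ : ∀ i ∈ s, PSOrdGe p 0 (Φ i)) (hΨ : ∀ i ∈ s, PSOrdGe p 0 (Ψ i))
    (h : ∀ i ∈ s, PSOrdGe p 1 (Φ i - Ψ i)) : PSOrdGe p 1 (∏ i ∈ s, Φ i - ∏ i ∈ s, Ψ i) := by
  classical
  induction s using Finset.induction_on with
  | empty => rw [prod_empty, prod_empty, sub_self]; exact zero p 1
  | insert a s ha ih =>
    rw [prod_insert ha, prod_insert ha]
    exact mul_congr (hΦ a (mem_insert_self a s)) (prod s fun i hi => hΨ i (mem_insert_of_mem hi))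
      (h a (mem_insert_self a s))
      (ih (fun i hi => hΦ i (mem_insert_of_mem hi)) (fun i hi => hΨ i (mem_insert_of_mem hi))
        fun i hi => h i (mem_insert_of_mem hi))

/-- Congruent series have congruent powers. [cite: Zudilin2004, §7 (Lemmas 16–18: Leibniz rule for (1/j!)R^{(j)}(−k))] -/
theorem pow_congr [Fact p.Prime] (hF : PSOrdGe p 0 F) (hG : PSOrdGe p 0 G) (h : PSOrdGe p 1 (F - G))
    (n : ℕ) : PSOrdGe p 1 (F ^ n - G ^ n) := by
  have := prod_congr (range n) (Φ := fun _ => F) (Ψ := fun _ => G) (fun _ _ => hF) (fun _ _ => hG)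
    fun _ _ => h
  simpa using this

end PSOrdGe

/-! ### The elementary series -/

section elementary

variable {p : ℕ} [hp : Fact p.Prime]

/-- A linear series `C w + p X` with `p`-integral value `w` is `p`-integral and `≡ C w (mod p)`.
[cite: Zudilin2004, §7 Lemma 17 (proof)] -/
theorem psOrdGe_lin {w : ℚ} (hw : PadicOrdGe p 0 w) :
    PSOrdGe p 0 (C w + C (p : ℚ) * X) ∧ PSOrdGe p 1 (C w + C (p : ℚ) * X - C w) := by
  refine ⟨(PSOrdGe.C hw).add ((PSOrdGe.C_p_mul_X p).mono (by norm_num)), ?_⟩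
  rw [add_sub_cancel_left]
  exact PSOrdGe.C_p_mul_X p

/-- A doubled linear series `C w + 2p X` (the factor `2t + n`): `p`-integral and `≡ C w (mod p)`.
[cite: RivoalZudilin2020, §3 (the factor 2t+n)] -/
theorem psOrdGe_lin_two {w : ℚ} (hw : PadicOrdGe p 0 w) :
    PSOrdGe p 0 (C w + C (2 * (p : ℚ)) * X) ∧ PSOrdGe p 1 (C w + C (2 * (p : ℚ)) * X - C w) := by
  have h2 : PSOrdGe p 1 (C (2 * (p : ℚ)) * X) := by
    have := ((PSOrdGe.C (PadicOrdGe.of_nat (p := p) 2)).mul (PSOrdGe.C_p_mul_X p))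
    simpa [map_mul, mul_assoc] using this
  refine ⟨(PSOrdGe.C hw).add (h2.mono (by norm_num)), ?_⟩
  rw [add_sub_cancel_left]
  exact h2

/-- The geometric series `invLin 1 β = Σ (−1)^j β^{−j−1} X^j` for a `p`-adic unit `β` (we only need
`ord_p β⁻¹ ≥ 0`) is `p`-integral. [cite: Zudilin2004, §7 Lemma 18 (proof)] -/
theorem psOrdGe_invLin_one {β : ℚ} (hβ : PadicOrdGe p 0 β⁻¹) : PSOrdGe p 0 (invLin 1 β) := fun j => by
  rw [coeff_invLin, div_eq_mul_inv, ← inv_pow]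
  have h1 : PadicOrdGe p 0 ((-1 : ℚ) ^ j) := by
    simpa using PadicOrdGe.of_int (p := p) ((-1) ^ j)
  simpa using h1.mul (by simpa using hβ.pow (j + 1))

/-- The geometric series `invLin p w = Σ (−p)^j w^{−j−1} X^j` at a `p`-adic unit `w`: `p`-integral and
`≡ C w⁻¹ (mod p)`. [cite: Zudilin2004, §7 Lemma 18 (proof)] -/
theorem psOrdGe_invLin_p {w : ℚ} (hw : PadicOrdGe p 0 w⁻¹) :
    PSOrdGe p 0 (invLin p w) ∧ PSOrdGe p 1 (invLin p w - C w⁻¹) := by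
  have hcoeff : ∀ j : ℕ, PadicOrdGe p (j : ℤ) (coeff j (invLin p w)) := fun j => by
    rw [coeff_invLin, div_eq_mul_inv, ← inv_pow, neg_pow, mul_assoc]
    have h1 : PadicOrdGe p 0 ((-1 : ℚ) ^ j) := by
      simpa using PadicOrdGe.of_int (p := p) ((-1) ^ j)
    have h2 : PadicOrdGe p (j : ℤ) ((p : ℚ) ^ j) := by
      simpa using (padicOrdGe_one_natCast p).pow j
    have h3 : PadicOrdGe p 0 (w⁻¹ ^ (j + 1)) := by simpa using hw.pow (j + 1)
    simpa using h1.mul (h2.mul h3)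
  refine ⟨fun j => (hcoeff j).mono (by positivity), fun j => ?_⟩
  rw [map_sub, coeff_C]
  rcases j with _ | j
  · rw [if_pos rfl, coeff_zero_eq_constantCoeff_apply, constantCoeff_invLin, sub_self]
    exact PadicOrdGe.zero 1
  · rw [if_neg (Nat.succ_ne_zero j), sub_zero]
    exact (hcoeff (j + 1)).mono (by push_cast; omega)

end elementary

end Literature.NumberTheory.Transcendental
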